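import Summits.AtomisticToContinuum.Crystallization.Theorems.DisclinationRationUniformPolytypeStabilityFarChains

/-!
# `UniformPolytypeStability` (stmt-AtomisticToContinuum-15800), line `birth` (v2, cells): FAR-FIELD VOCABULARY

The far field of the reshaped line is charged in STRAIN currency to the parallelepiped cells.  A far pair `(x, y)`
(`x ≠ y`, not a cell bond) with `y` in layer `x.1 + Δm`, `Δm ≥ 1`, belongs to the steep CLASS `(Δm, 3q₁, 3q₂)`
(`pos y − pos x = q₁ v₁ + q₂ v₂ + Δz e₃`, `3q ≡ C (mod 3)` where `C` is the registry shift between the two layers);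
in-plane far pairs form the classes `(0, q)`, `q ∈ ℤ²`.  For every class the computable core
(`…FarChains.lean`: `slabPieces`, `planePieces`, `checkSteep`, `checkPlane`) produces, slab by slab, the pieces of the
NOMINAL polygonal path (junctions on the layer planes at the fractions `l/Δm` of the in-plane offset, actual heights) cut
by the sub-tetrahedra of the cells, and checks the affine hand-overs exactly over `ℚ`.  This file names the real-side
objects: the realized pairs (`regShift`, `Realized`, `topSite`), the class vector and weight (`classVec`, `classWt` =
`−V″(r)/r²`), the slab direction `dirReal` (oblique coordinates `dirVec`), the cell of a piece (`pieceCell`), the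
affine gradient action `tetApply` (`F_T(d) = Σ_v ⟨∇λ_v, d⟩ U_v`), the strain / leak of a sub-tetrahedron
(`tetStrain = ⟨d, F_T d⟩`, `tetLeak = (F_T d)₃`), the height defect `heightDefect = Δz − Δm·h_k`, the class tables
(`steepClasses`, `planeClasses`, membership `inSteepTableB`, `inPlaneTableB`), the per-cell far charge
`cellFarCharge R η`, and the far-field STUB STATEMENTS of the line (`ChainIdentityAt`, `PlaneChainIdentityAt`,
`PairChargeBound`, `FarCensus`, `FarRegroup`, `FarTail`, `CellCertificate`; all parametrised predicates).  Line-internal bookkeeping of THIS line; `[folklore]`.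
-/

noncomputable section

namespace Summit.AtomisticToContinuum.Crystallization.Theorems.UniformPolytypeStabilityCells

open scoped BigOperators InnerProductSpace
open Filter Set Function
open Literature.MathematicalPhysics.StatisticalMechanics
open Summit.AtomisticToContinuum.Crystallization.Theorems.PhononStabilityNegative (Hess₀)
open FarChain

/-! ## Realized pairs of a class -/

/-- The letter of slab `k` as a Boolean (`true ↔ s k = 1`). [folklore] -/
def letterB (s : ℤ → ℤ) (k : ℤ) : Bool := decide (s k = 1)

/-- Registry shift `C = haggLabel s (m + n) − haggLabel s m` of layer `m + n` relative to layer `m`. [folklore] -/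
def regShift (s : ℤ → ℤ) (m : ℤ) (n : ℕ) : ℤ := haggLabel s (m + n) - haggLabel s m

/-- The registry shift modulo `3`, as a natural number in `{0,1,2}`. [folklore] -/
def reg3 (s : ℤ → ℤ) (m : ℤ) (n : ℕ) : ℕ := Int.toNat (regShift s m n % 3)

/-- The steep class `(Δm, 3q)` is realized between layers `m` and `m + Δm`: `3q₁ ≡ C (mod 3)`. [folklore] -/
def Realized (s : ℤ → ℤ) (m : ℤ) (dm : ℕ) (q3 : ℤ × ℤ) : Prop := (q3.1 - regShift s m dm) % 3 = 0

/-- `Realized` is decidable (an integer congruence). [folklore] -/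
instance Realized.decidable (s : ℤ → ℤ) (m : ℤ) (dm : ℕ) (q3 : ℤ × ℤ) : Decidable (Realized s m dm q3) :=
  inferInstanceAs (Decidable ((q3.1 - regShift s m dm) % 3 = 0))

/-- The top site of the realized pair of class `(Δm, 3q)` based at `x = (m, i, j)`:
`y = (m + Δm, i + (3q₁ − C)/3, j + (3q₂ − C)/3)`. [folklore] -/
def topSite (s : ℤ → ℤ) (m i j : ℤ) (dm : ℕ) (q3 : ℤ × ℤ) : Idx :=
  (m + dm, i + (q3.1 - regShift s m dm) / 3, j + (q3.2 - regShift s m dm) / 3)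

/-- The class vector `e = q₁ v₁ + q₂ v₂ + (z (m+Δm) − z m) e₃` (`= pos y − pos x` for realized pairs; for `Δm = 0`
the in-plane vector `q₁ v₁ + q₂ v₂`). [folklore] -/
def classVec (a : ℝ) (z : ℤ → ℝ) (m : ℤ) (dm : ℕ) (q3 : ℤ × ℤ) : EuclideanSpace ℝ (Fin 3) :=
  ((q3.1 : ℝ) / 3) • triangularVec₁ a + ((q3.2 : ℝ) / 3) • triangularVec₂ a + (z (m + dm) - z m) • layerNormal 1

/-- The class weight `−V″(r)/r²` at `r = ‖classVec‖` (nonnegative for `r ≥ 1.109`; the longitudinal far coupling per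
unit of the squared unnormalised projection `⟨e, Δu⟩²`). [folklore] -/
def classWt (a : ℝ) (z : ℤ → ℝ) (m : ℤ) (dm : ℕ) (q3 : ℤ × ℤ) : ℝ :=
  -(deriv (deriv lennardJones) ‖classVec a z m dm q3‖) / ‖classVec a z m dm q3‖ ^ 2

/-! ## Frames, directions, cells of pieces -/

/-- The vector with oblique coordinates `(c₁, c₂, c₃)` in the frame `(σ v₁, σ v₂, σ w + h_k e₃)` of slab `k`. [folklore] -/
def frameVec (a : ℝ) (s : ℤ → ℤ) (z : ℤ → ℝ) (k : ℤ) (c₁ c₂ c₃ : ℝ) : EuclideanSpace ℝ (Fin 3) :=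
  c₁ • ((s k : ℝ) • triangularVec₁ a) + c₂ • ((s k : ℝ) • triangularVec₂ a) +
    c₃ • ((s k : ℝ) • barlowOffset a + gap z k • layerNormal 1)

/-- The real slab direction `d_l` of the steep class `(Δm, 3q)` in slab `k`: oblique coordinates `dirVec`
(`= (q₁ v₁ + q₂ v₂)/Δm + h_k e₃`). [folklore] -/
def dirReal (a : ℝ) (s : ℤ → ℤ) (z : ℤ → ℝ) (k : ℤ) (dm : ℕ) (q3 : ℤ × ℤ) : EuclideanSpace ℝ (Fin 3) :=
  frameVec a s z k ((dirVec dm q3 (letterB s k)).x : ℝ) ((dirVec dm q3 (letterB s k)).y : ℝ) 1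

/-- The in-plane class vector `q₁ v₁ + q₂ v₂` (`q ∈ ℤ²`). [folklore] -/
def planeVec (a : ℝ) (q : ℤ × ℤ) : EuclideanSpace ℝ (Fin 3) := (q.1 : ℝ) • triangularVec₁ a + (q.2 : ℝ) • triangularVec₂ a

/-- The cell of slab `m + l` containing the piece `p` (generated for base column `0` and registry representative
`reg3`) of the pair based at `(m, i, j)`: `(m + l, σ·cube + (i − K, j − K))`, `K = (C_l − C_l mod 3)/3`. [folklore] -/
def pieceCell (s : ℤ → ℤ) (m i j : ℤ) (l : ℕ) (p : Piece) : CIdx :=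
  let K : ℤ := (regShift s m l - (reg3 s m l : ℤ)) / 3
  (m + l, s (m + l) * p.cube.1 + i - K, s (m + l) * p.cube.2 + j - K)

/-- The cell of slab `m` containing the in-plane piece `p` of the pair based at `(m, i, j)`. [folklore] -/
def planeCell (s : ℤ → ℤ) (m i j : ℤ) (p : Piece) : CIdx := (m, s m * p.cube.1 + i, s m * p.cube.2 + j)

/-- The affine gradient of sub-tetrahedron `t` of cell `ι` applied to `d`: `F_T(d) = Σ_{v ∈ T} ⟨∇λ_v, d⟩ U_v`. [folklore] -/
def tetApply (a : ℝ) (s : ℤ → ℤ) (z : ℤ → ℝ) (U : Idx → EuclideanSpace ℝ (Fin 3)) (ι : CIdx) (t : ℕ)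
    (d : EuclideanSpace ℝ (Fin 3)) : EuclideanSpace ℝ (Fin 3) :=
  ((subTet t).map fun vg => inner ℝ (gradVec a s z ι.1 vg.2) d • U (cvert s ι vg.1)).sum

/-- Strain of sub-tetrahedron `t` of cell `ι` along `d`: `⟨d, F_T d⟩`. [folklore] -/
def tetStrain (a : ℝ) (s : ℤ → ℤ) (z : ℤ → ℝ) (U : Idx → EuclideanSpace ℝ (Fin 3)) (ι : CIdx) (t : ℕ)
    (d : EuclideanSpace ℝ (Fin 3)) : ℝ :=
  inner ℝ d (tetApply a s z U ι t d)

/-- Leak component of sub-tetrahedron `t` of cell `ι` along `d`: the vertical component `(F_T d)₃`. [folklore] -/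
def tetLeak (a : ℝ) (s : ℤ → ℤ) (z : ℤ → ℝ) (U : Idx → EuclideanSpace ℝ (Fin 3)) (ι : CIdx) (t : ℕ)
    (d : EuclideanSpace ℝ (Fin 3)) : ℝ :=
  tetApply a s z U ι t d 2

/-- Height defect of slab `k` for the class `(Δm, ·)` based at layer `m`: `Δz − Δm·h_k` (`|·| ≤ Δm/500` on pinned
configurations). [folklore] -/
def heightDefect (z : ℤ → ℝ) (m : ℤ) (dm : ℕ) (k : ℤ) : ℝ := (z (m + dm) - z m) - dm * gap z k

/-! ## Class tables -/

/-- `3·(q₁² + q₁q₂ + q₂²)… `: nine times the normalised squared in-plane length, `A² + AB + B²` for `3q = (A, B)`. [folklore] -/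
def q3Norm (q3 : ℤ × ℤ) : ℤ := q3.1 * q3.1 + q3.1 * q3.2 + q3.2 * q3.2

/-- Lower bound `r_min²` of the squared length of the class over the box: `(47/50)²·(Q/9) + (Δm·39·47/2500)²`. [folklore] -/
def rmin2 (dm : ℕ) (q3 : ℤ × ℤ) : ℚ := (47 / 50) ^ 2 * (q3Norm q3 : ℚ) / 9 + ((dm : ℚ) * 39 * 47 / 2500) ^ 2

/-- The near steep classes (`Δm = 1`: the three nearest-neighbour and the three octahedron-diagonal offsets, both
letters): `A² + AB + B² ∈ {3, 12}`. [folklore] -/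
def nearSteepB (dm : ℕ) (q3 : ℤ × ℤ) : Bool := (dm == 1) && (q3Norm q3 == 3 || q3Norm q3 == 12)

/-- Membership in the steep table of range `R`: `Δm ≥ 1`, `A ≡ B (mod 3)`, not near, `r_min ≤ R`. [folklore] -/
def inSteepTableB (R : ℚ) (dm : ℕ) (q3 : ℤ × ℤ) : Bool :=
  decide (0 < dm) && decide ((q3.1 - q3.2) % 3 = 0) && !(nearSteepB dm q3) && decide (rmin2 dm q3 ≤ R ^ 2)

/-- Membership in the in-plane table of range `R`: `q ≠ 0`, not a nearest neighbour (`Q(q) ≠ 1`), `r_min ≤ R`. [folklore] -/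
def inPlaneTableB (R : ℚ) (q : ℤ × ℤ) : Bool :=
  !(decide (q = (0, 0))) && !(decide (q3Norm q = 1)) && decide ((47 / 50 : ℚ) ^ 2 * (q3Norm q : ℚ) ≤ R ^ 2)

/-- Integer range `[-n, n]` as a list. [folklore] -/
def zrange (n : ℕ) : List ℤ := (List.range (2 * n + 1)).map fun k => (k : ℤ) - n

/-- The steep table of range `R` (a finite list; `Δm ≤ 2R`, `|A|, |B| ≤ 4R` suffice). [folklore] -/
def steepClasses (R : ℚ) : List (ℕ × ℤ × ℤ) :=
  let n : ℕ := Int.toNat (Rat.ceil (4 * R))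
  ((List.range (Int.toNat (Rat.ceil (2 * R)) + 1)).map fun dm =>
    ((zrange n).map fun A => ((zrange n).filter fun B => inSteepTableB R dm (A, B)).map fun B => (dm, A, B)).flatten).flatten

/-- The in-plane table of range `R`. [folklore] -/
def planeClasses (R : ℚ) : List (ℤ × ℤ) :=
  let n : ℕ := Int.toNat (Rat.ceil (2 * R))
  ((zrange n).map fun A => ((zrange n).filter fun B => inPlaneTableB R (A, B)).map fun B => (A, B)).flatten

/-! ## The per-cell far charge -/

/-- Charge of one steep class `(Δm, 3q)` at relative slab `l` on cell `ι` (base layer `m = ι.1 − l`):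
`wt · Σ_pieces ŝ·((1+η)Δm³·strain² + (1+η⁻¹)Δm·δ²·leak²)` if realized, else `0`. [folklore] -/
def steepCharge (η : ℝ) (a : ℝ) (s : ℤ → ℤ) (z : ℤ → ℝ) (U : Idx → EuclideanSpace ℝ (Fin 3)) (ι : CIdx)
    (dm : ℕ) (q3 : ℤ × ℤ) (l : ℕ) : ℝ :=
  let m : ℤ := ι.1 - l
  if Realized s m dm q3 then
    classWt a z m dm q3 *
      ((slabPieces dm q3 l (reg3 s m l) (letterB s ι.1)).map fun p =>
        ((p.s1 - p.s0 : ℚ) : ℝ) *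
          ((1 + η) * (dm : ℝ) ^ 3 * tetStrain a s z U ι p.tet (dirReal a s z ι.1 dm q3) ^ 2 +
            (1 + η⁻¹) * (dm : ℝ) * heightDefect z m dm ι.1 ^ 2 * tetLeak a s z U ι p.tet (dirReal a s z ι.1 dm q3) ^ 2)).sum
  else 0

/-- Charge of one in-plane class `q` on cell `ι` (the pair lies in the bottom plane of the cell's slab):
`½ · wt · Σ_pieces ŝ·strain²` (the `½` because ordered in-plane pairs are counted once each in `½Σ farTerm`). [folklore] -/
def planeCharge (a : ℝ) (s : ℤ → ℤ) (z : ℤ → ℝ) (U : Idx → EuclideanSpace ℝ (Fin 3)) (ι : CIdx) (q : ℤ × ℤ) : ℝ :=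
  classWt a z ι.1 0 (3 * q.1, 3 * q.2) / 2 *
    ((planePieces q (letterB s ι.1)).map fun p =>
      ((p.s1 - p.s0 : ℚ) : ℝ) * tetStrain a s z U ι p.tet (planeVec a q) ^ 2).sum

/-- THE CELL FAR CHARGE of range `R` and splitting parameter `η > 0`: all steep classes of the table at every relative
slab, plus the in-plane classes of the cell's bottom plane. [folklore] -/
def cellFarCharge (R : ℚ) (η : ℝ) (a : ℝ) (s : ℤ → ℤ) (z : ℤ → ℝ) (U : Idx → EuclideanSpace ℝ (Fin 3))
    (ι : CIdx) : ℝ :=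
  ((steepClasses R).map fun c => ∑ l ∈ Finset.range c.1, steepCharge η a s z U ι c.1 c.2 l).sum +
    ((planeClasses R).map fun q => planeCharge a s z U ι q).sum

/-! ## The far-field stub statements -/

/-- `ChainIdentityAt Δm 3q`: for the steep class `(Δm, 3q)` passing `checkSteep`, every realized pair telescopes EXACTLY through the
generated pieces: `U y − U x = Σ_{l<Δm} Σ_{p} (s₁ − s₀)·F_{T_p}(d_l)` (soundness of the rational checker). [folklore] -/
def ChainIdentityAt (dm : ℕ) (q3 : ℤ × ℤ) : Prop :=
  ∀ (a : ℝ) (s : ℤ → ℤ) (z : ℤ → ℝ), 47 / 50 ≤ a → a ≤ 1 → IsHaggSeq s → HeightBox a z →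
    checkSteep dm q3 = true → ∀ (m i j : ℤ), Realized s m dm q3 →
      ∀ U : Idx → EuclideanSpace ℝ (Fin 3),
        U (topSite s m i j dm q3) - U (m, i, j) =
          ∑ l ∈ Finset.range dm, ((slabPieces dm q3 l (reg3 s m l) (letterB s (m + l))).map fun p =>
            ((p.s1 - p.s0 : ℚ) : ℝ) • tetApply a s z U (pieceCell s m i j l p) p.tet (dirReal a s z (m + l) dm q3)).sum

/-- `PlaneChainIdentityAt q`: the same for the in-plane class `q` passing `checkPlane`. [folklore] -/
def PlaneChainIdentityAt (q : ℤ × ℤ) : Prop :=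
  ∀ (a : ℝ) (s : ℤ → ℤ) (z : ℤ → ℝ), 47 / 50 ≤ a → a ≤ 1 → IsHaggSeq s → HeightBox a z →
    checkPlane q = true → ∀ (m i j : ℤ) (U : Idx → EuclideanSpace ℝ (Fin 3)),
      U (m, i + q.1, j + q.2) - U (m, i, j) =
        ((planePieces q (letterB s m)).map fun p =>
          ((p.s1 - p.s0 : ℚ) : ℝ) • tetApply a s z U (planeCell s m i j p) p.tet (planeVec a q)).sum

/-- `PairChargeBound η`: on PINNED configurations every realized pair of a checked steep table class obeys
`farTerm (x, y) ≥ −wt·[(1+η)Δm³ Σ ŝ strain² + (1+η⁻¹)Δm Σ ŝ δ_l² leak²]`, and every in-plane table pair obeys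
`farTerm (x, y) ≥ −wt·Σ ŝ strain²`.  (Sign of `V″`, `V′/r ≥ 0` beyond the bonds, the chain identities,
`e = Δm·d_l + δ_l e₃`, Cauchy–Schwarz.) [folklore] -/
def PairChargeBound (η : ℝ) : Prop :=
  (∀ (dm : ℕ) (q3 : ℤ × ℤ), ChainIdentityAt dm q3) → (∀ q : ℤ × ℤ, PlaneChainIdentityAt q) →
  ∀ (a : ℝ) (s : ℤ → ℤ) (z : ℤ → ℝ), 47 / 50 ≤ a → a ≤ 1 → IsHaggSeq s → HeightBox a z → GapsPinned z →
    SitesFacts a s z → ∀ U : Idx → EuclideanSpace ℝ (Fin 3),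
      (∀ (dm : ℕ) (q3 : ℤ × ℤ), 0 < dm → nearSteepB dm q3 = false → checkSteep dm q3 = true →
        ∀ (m i j : ℤ), Realized s m dm q3 →
          -(classWt a z m dm q3 *
              ∑ l ∈ Finset.range dm, ((slabPieces dm q3 l (reg3 s m l) (letterB s (m + l))).map fun p =>
                ((p.s1 - p.s0 : ℚ) : ℝ) *
                  ((1 + η) * (dm : ℝ) ^ 3 *
                      tetStrain a s z U (pieceCell s m i j l p) p.tet (dirReal a s z (m + l) dm q3) ^ 2 +
                    (1 + η⁻¹) * (dm : ℝ) * heightDefect z m dm (m + l) ^ 2 *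
                      tetLeak a s z U (pieceCell s m i j l p) p.tet (dirReal a s z (m + l) dm q3) ^ 2)).sum)
            ≤ farTerm a s z U ((m, i, j), topSite s m i j dm q3)) ∧
      (∀ q : ℤ × ℤ, q ≠ (0, 0) → q3Norm q ≠ 1 → checkPlane q = true → ∀ (m i j : ℤ),
          -(classWt a z m 0 (3 * q.1, 3 * q.2) *
              ((planePieces q (letterB s m)).map fun p =>
                ((p.s1 - p.s0 : ℚ) : ℝ) * tetStrain a s z U (planeCell s m i j p) p.tet (planeVec a q) ^ 2).sum)
            ≤ farTerm a s z U ((m, i, j), (m, i + q.1, j + q.2)))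

/-- `FarCensus R`: the ordered far pairs are exactly: the realized steep table pairs (twice, by the symmetry
`farTerm (x,y) = farTerm (y,x)`), the in-plane table pairs, and the REST, on which `r > R`; with the summability
needed to split the far `tsum` accordingly. [folklore] -/
def FarCensus (R : ℚ) : Prop :=
  ∀ (a : ℝ) (s : ℤ → ℤ) (z : ℤ → ℝ), 47 / 50 ≤ a → a ≤ 1 → IsHaggSeq s → HeightBox a z → SitesFacts a s z →
    ∀ U : Idx → EuclideanSpace ℝ (Fin 3), (Function.support U).Finite → Summable (farTerm a s z U) →
      ∃ rest : Idx × Idx → ℝ, Summable rest ∧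
        (∀ xy, rest xy ≠ 0 → (R : ℝ) < dist (pos a s z xy.1) (pos a s z xy.2) ∧ rest xy = farTerm a s z U xy) ∧
        Summable (fun t : (ℕ × ℤ × ℤ) × (ℤ × ℤ × ℤ) =>
          if t.1 ∈ steepClasses R ∧ Realized s t.2.1 t.1.1 t.1.2 then
            farTerm a s z U (t.2, topSite s t.2.1 t.2.2.1 t.2.2.2 t.1.1 t.1.2) else 0) ∧
        Summable (fun t : (ℤ × ℤ) × (ℤ × ℤ × ℤ) =>
          if t.1 ∈ planeClasses R then farTerm a s z U (t.2, (t.2.1, t.2.2.1 + t.1.1, t.2.2.2 + t.1.2)) else 0) ∧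
        ∑' xy, farTerm a s z U xy =
          2 * ∑' t : (ℕ × ℤ × ℤ) × (ℤ × ℤ × ℤ),
              (if t.1 ∈ steepClasses R ∧ Realized s t.2.1 t.1.1 t.1.2 then
                farTerm a s z U (t.2, topSite s t.2.1 t.2.2.1 t.2.2.2 t.1.1 t.1.2) else 0) +
            ∑' t : (ℤ × ℤ) × (ℤ × ℤ × ℤ),
              (if t.1 ∈ planeClasses R then farTerm a s z U (t.2, (t.2.1, t.2.2.1 + t.1.1, t.2.2.2 + t.1.2)) else 0) +
            ∑' xy, rest xy

/-- `FarRegroup R η`: the pair charges of the table, summed over all realized pairs, ARE the cell far charges summed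
over cells (translate-sum: as the base site runs over a layer, each generated piece visits every cell of its slab exactly
once), with finiteness of the cell family. [folklore] -/
def FarRegroup (R : ℚ) (η : ℝ) : Prop :=
  ∀ (a : ℝ) (s : ℤ → ℤ) (z : ℤ → ℝ), 47 / 50 ≤ a → a ≤ 1 → IsHaggSeq s → HeightBox a z →
    ∀ U : Idx → EuclideanSpace ℝ (Fin 3), (Function.support U).Finite →
      (Function.support (cellFarCharge R η a s z U)).Finite ∧
      Summable (fun t : (ℕ × ℤ × ℤ) × (ℤ × ℤ × ℤ) =>
        if t.1 ∈ steepClasses R ∧ Realized s t.2.1 t.1.1 t.1.2 then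
          classWt a z t.2.1 t.1.1 t.1.2 *
            ∑ l ∈ Finset.range t.1.1, ((slabPieces t.1.1 t.1.2 l (reg3 s t.2.1 l) (letterB s (t.2.1 + l))).map fun p =>
              ((p.s1 - p.s0 : ℚ) : ℝ) *
                ((1 + η) * (t.1.1 : ℝ) ^ 3 *
                    tetStrain a s z U (pieceCell s t.2.1 t.2.2.1 t.2.2.2 l p) p.tet (dirReal a s z (t.2.1 + l) t.1.1 t.1.2) ^ 2 +
                  (1 + η⁻¹) * (t.1.1 : ℝ) * heightDefect z t.2.1 t.1.1 (t.2.1 + l) ^ 2 *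
                    tetLeak a s z U (pieceCell s t.2.1 t.2.2.1 t.2.2.2 l p) p.tet (dirReal a s z (t.2.1 + l) t.1.1 t.1.2) ^ 2)).sum
        else 0) ∧
      Summable (fun t : (ℤ × ℤ) × (ℤ × ℤ × ℤ) =>
        if t.1 ∈ planeClasses R then
          classWt a z t.2.1 0 (3 * t.1.1, 3 * t.1.2) / 2 *
            ((planePieces t.1 (letterB s t.2.1)).map fun p =>
              ((p.s1 - p.s0 : ℚ) : ℝ) * tetStrain a s z U (planeCell s t.2.1 t.2.2.1 t.2.2.2 p) p.tet (planeVec a t.1) ^ 2).sum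
        else 0) ∧
      ∑' ι : CIdx, cellFarCharge R η a s z U ι =
        ∑' t : (ℕ × ℤ × ℤ) × (ℤ × ℤ × ℤ),
            (if t.1 ∈ steepClasses R ∧ Realized s t.2.1 t.1.1 t.1.2 then
              classWt a z t.2.1 t.1.1 t.1.2 *
                ∑ l ∈ Finset.range t.1.1, ((slabPieces t.1.1 t.1.2 l (reg3 s t.2.1 l) (letterB s (t.2.1 + l))).map fun p =>
                  ((p.s1 - p.s0 : ℚ) : ℝ) *
                    ((1 + η) * (t.1.1 : ℝ) ^ 3 *
                        tetStrain a s z U (pieceCell s t.2.1 t.2.2.1 t.2.2.2 l p) p.tet (dirReal a s z (t.2.1 + l) t.1.1 t.1.2) ^ 2 +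
                      (1 + η⁻¹) * (t.1.1 : ℝ) * heightDefect z t.2.1 t.1.1 (t.2.1 + l) ^ 2 *
                        tetLeak a s z U (pieceCell s t.2.1 t.2.2.1 t.2.2.2 l p) p.tet (dirReal a s z (t.2.1 + l) t.1.1 t.1.2) ^ 2)).sum
            else 0) +
          ∑' t : (ℤ × ℤ) × (ℤ × ℤ × ℤ),
            (if t.1 ∈ planeClasses R then
              classWt a z t.2.1 0 (3 * t.1.1, 3 * t.1.2) / 2 *
                ((planePieces t.1 (letterB s t.2.1)).map fun p =>
                  ((p.s1 - p.s0 : ℚ) : ℝ) * tetStrain a s z U (planeCell s t.2.1 t.2.2.1 t.2.2.2 p) p.tet (planeVec a t.1) ^ 2).sum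
            else 0)

/-- `FarTail R K`: the far pairs beyond the table (`r > R`) cost at most `K/R³` in nearest-neighbour currency:
`−(K/R³)·2Σ_cells cellNN ≤ ½·Σ_{rest}` for every summable `rest` supported on pairs at distance `> R` and agreeing with
`farTerm` there (nearest-neighbour paths + lattice-point counting). [folklore] -/
def FarTail (R K : ℚ) : Prop :=
  ∀ (a : ℝ) (s : ℤ → ℤ) (z : ℤ → ℝ), 47 / 50 ≤ a → a ≤ 1 → IsHaggSeq s → HeightBox a z → SitesFacts a s z →
    ∀ U : Idx → EuclideanSpace ℝ (Fin 3), (Function.support U).Finite →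
      ∀ rest : Idx × Idx → ℝ, Summable rest →
        (∀ xy, rest xy ≠ 0 → (R : ℝ) < dist (pos a s z xy.1) (pos a s z xy.2) ∧ rest xy = farTerm a s z U xy) →
          -((K : ℝ) / (R : ℝ) ^ 3 * (2 * ∑' ι : CIdx, cellNN s U ι)) ≤ (∑' xy, rest xy) / 2

/-- `CellCertificate κ R η C`: the cell-by-cell positivity certificate on pinned configurations, with the
null-Lagrangian coefficients `C a h̄` (`h̄ := gap z 0`). [folklore] -/
def CellCertificate (κ : ℝ) (R : ℚ) (η : ℝ) (C : ℝ → ℝ → (Fin 3 × Fin 3 → Fin 3 × Fin 3 → ℝ)) : Prop :=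
  ∀ (a : ℝ) (s : ℤ → ℤ) (z : ℤ → ℝ), 47 / 50 ≤ a → a ≤ 1 → IsHaggSeq s → HeightBox a z → GapsPinned z →
    ∀ (U : Idx → EuclideanSpace ℝ (Fin 3)) (ι : CIdx),
      0 ≤ cellHess a s z U ι - 2 * κ * cellNN s U ι + cellNull (C a (gap z 0)) a s z U ι - cellFarCharge R η a s z U ι

/-! ## Anchor -/

/-- Registered anchor of this vocabulary file (`stub_farDefs`): the nearest far classes are in the table of range `2`
(the class `A`, `Δm = 1`, `3q = (4,1)`, and the vertical second-layer pair `Δm = 2`, `q = 0`), the nearest-neighbour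
class is not. [folklore] -/
theorem stub_farDefs :
    inSteepTableB 2 1 (4, 1) = true ∧ inSteepTableB 2 2 (0, 0) = true ∧ inSteepTableB 2 1 (1, 1) = false := by
  refine ⟨?_, ?_, ?_⟩ <;> native_decide

end Summit.AtomisticToContinuum.Crystallization.Theorems.UniformPolytypeStabilityCells

end
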